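import Summits.BirchSwinnertonDyer.Rank1Residual.X6.RankZeroCertificateErratumDisplay
import Summits.BirchSwinnertonDyer.BirchSwinnertonDyer.Theorems.PrintX6EisensteinHalfFiveLeRestResidual
import Literature.NumberTheory.EllipticCurves.AnalyticRankOrderProofs
import Summits.BirchSwinnertonDyer.Rank1Residual.Supersingular.AnalyticRankZeroOfLOneBall
import HarnessLib

/-!
# Class X6 ∧ analytic rank `0` — `BSD(E,p)` for every certificate record on the route's OWN items after the
# Err child closed: per record, per list, and in the `hWeq` shape of the cell files

Cell `bsd-print-x6` (D-0131 (2) print tier, key `x6`; HOME `run/shared/lean/pub/bsd-print-x6/`), typer seat ty3 (gen 5).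
Sibling of `RankZeroCertificateClaim.lean` (p536295: `Record.Claim`; `BSD(E,p)` per record on the SOCKET / PRINT / SCOPED /
DESCENT / UNIT roads) and of `RankZeroCertificateErratumDisplay.lean` (p551397: the Err ∣ Rest partition of the 734 records,
`hasErratumPrime_of_mem` / `not_hasErratumPrime_of_mem`), composed with prover p2's leaf-currency sockets of
`Theorems/PrintX6EisensteinHalfFiveLeRestResidual.lean` (p554990, after p3's closer p553619 of the Err child
`EisensteinHalfFiveLeErr`). PARTITION (D-0054): leaf X6 ∧ r = 0 (K3 row A6) — types-the-object-of; closes NONE.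

HONEST FRAMING: BSD is not proved here for any class or curve outright. Every `BSD(E,p)` below is per pair and
CONDITIONAL, by name, on (a) the route's input conjunction `PublishedInputsX6` (nine refereed facts, item
stmt-BirchSwinnertonDyer-20302), (b) for Err records the anticyclotomic pack `PublishedAcInputsX6Err`
(stmt-BirchSwinnertonDyer-21114; tier HELD on its conjunct (10), the referee rules), (c) for Rest records the OPEN residual
crux `EisensteinHalfFiveLeRest` (stmt-BirchSwinnertonDyer-21116), (d) for `p = 3` records the OPEN residual crux
`EisensteinHalfAtThree` (stmt-BirchSwinnertonDyer-20285), and (e) the record's two-engine CLAIM `Record.Claim` (analytic rank `0`;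
engine T = Cremona's exact modular-symbol `L(E,1)/Ω`, engine P = PARI/GP on the kit farm) — or, in the `hWeq` adapters,
an explicit `r_an = 0` hypothesis / an explicit enclosure line of the cell files' shape. `ClassX6`, `HasErratumPrime` /
`¬ HasErratumPrime`, `Fact p.Prime`, `IsElliptic`, `IsGloballyMinimal` are KERNEL theorems from the recheck (p534321,
p548448). The unrefereed preprint BSTW arXiv:2409.01350 is NOT used anywhere in this file.

WHAT THE DISPLAY SAYS (the census of record × the route's item structure, rev 9):
* §1 per record `r` (certified, claim holds): ERR road `Record.bsdp_of_errAt` — `5 ≤ p`, Err certificate ⇒ `BSD(E,p)` over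
  `PublishedInputsX6 ∧ PublishedAcInputsX6Err` and NO open crux (the 107 Err records at `p ≥ 5`,
  `errRest_counts_allRecords`); REST road `Record.bsdp_of_restAt` — over `PublishedInputsX6` + the open crux
  `EisensteinHalfFiveLeRest` (6 records); `p = 3` road `Record.bsdp_of_p_eq_three` — over `PublishedInputsX6` + the open
  crux `EisensteinHalfAtThree` (621 records); and `Record.bsdp_of_residuals` — any certified record over all four
  (classical case split, no certificate needed).
* §2 list forms, instance-free (`certified rs`, `Claims rs`), and the census corollaries over `allRecords`:
  `bsdp_of_mem_errAt` (107 cells, no open crux), `bsdp_of_mem_of_residuals` (all 734), `openCrux_count_allRecords`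
  (exactly 627 = 6 + 621 records wait on an OPEN crux; 107 do not).
* §3 `hWeq` adapters for the cell files (any of the 734 cells, `by decide +kernel` membership in `recordsNN`):
  `bsdp_of_exists_errAt` (`hPub`, `hAc`, `h0 : W.analyticRank = 0`), `bsdp_of_exists_restAt` (`hRest`),
  `bsdp_of_exists_three` (`hT`); §4 the claim's first conjunct from an ENCLOSURE LINE: (i) verbatim the cell files'
  level-one binder `hball0 : ∃ mid rad, rad ≤ R ∧ |mid − I| ≤ Mr ∧ |den·(c·(Re L(E,1)/Ω⁺_f)) − mid| ≤ rad` (`I ≠ 0`,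
  `R + Mr < 1`) through the tree's UNCONDITIONAL `Supersingular.analyticRank_eq_zero_of_LOneBall` (x10b gen 21) —
  `bsdp_of_exists_errAt_of_LOneBall`; (ii) the period-agnostic variant `analyticRank_eq_zero_of_enclosure` (any real `Ω`,
  e.g. an engine's `ω₁` itself; `|c·(c'·(Re L(E,1)/Ω)) − mid| ≤ rad ≤ ε`, `|mid − v| ≤ ε`, `v ∈ ℤ ∖ {0}`, `2ε < 1`; uses
  modularity, conjunct 8 of the pack) and `bsdp_of_exists_errAt_of_enclosure`; inhabited at the route's T3 witness cell:
  `bsdp_cell_22678e1_at5_of_publishedInputsX6_of_publishedAcInputsX6Err` (an Err cell; second road next to p4's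
  descent closure p546341, same input pack + `PublishedAcInputsX6Err`, no Cassels–Tate, no Selmer certificate).

Two engines behind the certificates: HOME/ty3/erratum/X6R0-ERRATUM-v1.tsv (pure Python Tate `−c₆` criterion = PARI `a_q`,
0 mismatches) and the kernel (`decide +kernel`). beyond-print theorem: NO (bookkeeping over landed theorems).
References: Kobayashi 2003 Thm. 1.2 / 4.1 [Kobayashi2003]; B. D. Kim 2013 Cor. 3.15 [BDKim2013]; Miller 2011 Def. 1.1
[Miller2011LMS]; Silverman *AEC* VII.5 Prop. 5.1 [SilvermanAEC2009]; Birch–Swinnerton-Dyer 1965 (order of vanishing)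
[BirchSwinnertonDyer1965]; Mazur–Tate–Teitelbaum 1986 §I.8 (`Ω⁺_f`) [MazurTateTeitelbaum1986Invent]; Cremona's tables
[Cremona2006]; HOME/PLAN.md v4.2–v4.4.
-/

set_option autoImplicit false

open scoped MatrixGroups ModularForm

open CongruenceSubgroup WeierstrassCurve Literature.NumberTheory.EllipticCurves
  Literature.NumberTheory.EllipticCurves.ModularForms
  Literature.NumberTheory.EllipticCurves.Rank1Residual
  Summit.BirchSwinnertonDyer.BirchSwinnertonDyer.Theses.PrintX6
-- only these names from the `Supersingular` namespace (ty2's `PublishedAcInputsX6Err` there would clash with the route's)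
open Summit.BirchSwinnertonDyer.Rank1Residual.Supersingular (HasErratumPrime analyticRank_eq_zero_of_LOneBall)

namespace Summit.BirchSwinnertonDyer.Rank1Residual.X6.PrintCert

/-! ### §1 Per record: `BSD(E,p)` on the route's own items, by certificate -/

namespace Record

variable (r : Record) [Fact r.p.Prime] [r.curve.IsElliptic] [r.curve.IsGloballyMinimal]

/-- **ERR road (no open crux).** For a certified record at `p ≥ 5` with the Err certificate (`errAt`: a listed bad prime
`q` non-split with `p ∤ ord_q Δ`, so `HasErratumPrime`, kernel theorem `hasErratumPrime_of_check`) whose claim holds: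
`BSD(E,p)` over the route's two input conjunctions — upper half = the route's PROVED `UpperHalfX6`, lower half = the
CLOSED Err child (`AnticyclotomicRankZero.eisensteinHalfFiveLeErr_holds`), via p2's
`X6.bsdp_of_publishedInputsX6_of_publishedAcInputsX6Err_of_hasErratumPrime`; `ClassX6` from the recheck, `r_an = 0` the
claim. CONDITIONAL on `PublishedInputsX6` and `PublishedAcInputsX6Err` (pack tier HELD). What each of the 107 Err census
cells at `p ≥ 5` inherits. [cite: Kobayashi2003, Thm. 1.2 (p. 2) and Thm. 4.1 (p. 8)] [cite: BDKim2013, Cor. 3.15 (p. 199)]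
[cite: SilvermanAEC2009, VII.5 Prop. 5.1(b)] [cite: Miller2011LMS, §1 and Def. 1.1] -/
theorem bsdp_of_errAt (hPub : PublishedInputsX6) (hAc : PublishedAcInputsX6Err) (hc : r.check = true)
    (h : r.Claim) (h5 : 5 ≤ r.p) (he : r.errAt = true) : BSDp r.curve r.p :=
  Summit.BirchSwinnertonDyer.BirchSwinnertonDyer.Theorems.X6.bsdp_of_publishedInputsX6_of_publishedAcInputsX6Err_of_hasErratumPrime
    r.curve r.p hPub hAc h5 (r.classX6_of_check hc) h.1 (r.hasErratumPrime_of_check hc he)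

/-- **REST road (open crux `EisensteinHalfFiveLeRest`).** For a certified record at `p ≥ 5` with the Rest certificate
(`restAt`: every listed bad prime split or with `p ∣ ord_q Δ`, so `¬ HasErratumPrime`, kernel theorem
`not_hasErratumPrime_of_check`) whose claim holds: `BSD(E,p)` over `PublishedInputsX6` and the residual crux (p2's
`X6.bsdp_of_publishedInputsX6_of_rest_of_not_hasErratumPrime`). CONDITIONAL on both; the 6 Rest census cells at `p ≥ 5`.
[cite: Kobayashi2003, Thm. 1.2 (p. 2) and Thm. 4.1 (p. 8)] [cite: BDKim2013, Cor. 3.15 (p. 199)]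
[cite: SilvermanAEC2009, VII.5 Prop. 5.1(a) and (b)] [cite: Miller2011LMS, §1 and Def. 1.1] -/
theorem bsdp_of_restAt (hPub : PublishedInputsX6) (hRest : EisensteinHalfFiveLeRest) (hc : r.check = true)
    (h : r.Claim) (h5 : 5 ≤ r.p) (hrest : r.restAt = true) : BSDp r.curve r.p :=
  Summit.BirchSwinnertonDyer.BirchSwinnertonDyer.Theorems.X6.bsdp_of_publishedInputsX6_of_rest_of_not_hasErratumPrime
    r.curve r.p hPub hRest h5 (r.classX6_of_check hc) h.1 (r.not_hasErratumPrime_of_check hc hrest)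

/-- **`p = 3` road (open crux `EisensteinHalfAtThree`).** For a certified record at `p = 3` whose claim holds:
`BSD(E,3)` over `PublishedInputsX6` and the `p = 3` residual crux (p2's `X6.bsdp_of_publishedInputsX6_of_atThree`).
CONDITIONAL on both; the 621 census cells at `p = 3`. [cite: Kobayashi2003, Thm. 1.2 (p. 2) and Thm. 4.1 (p. 8)]
[cite: BDKim2013, Cor. 3.15 (p. 199)] [cite: Miller2011LMS, §1 and Def. 1.1] -/
theorem bsdp_of_p_eq_three (hPub : PublishedInputsX6) (hT : EisensteinHalfAtThree) (hc : r.check = true)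
    (h : r.Claim) (h3 : r.p = 3) : BSDp r.curve r.p :=
  Summit.BirchSwinnertonDyer.BirchSwinnertonDyer.Theorems.X6.bsdp_of_publishedInputsX6_of_atThree
    r.curve r.p hPub hT h3 (r.classX6_of_check hc) h.1

/-- **Any certified record over the route's four open-or-held items** (no certificate needed: a certified `p` is `3` or
`≥ 5`, and at `p ≥ 5` the case split on `HasErratumPrime` is classical): `PublishedInputsX6`, `PublishedAcInputsX6Err`,
`EisensteinHalfFiveLeRest`, `EisensteinHalfAtThree` and the record's claim give `BSD(E,p)`. CONDITIONAL on all of them.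
[cite: Kobayashi2003, Thm. 1.2 (p. 2) and Thm. 4.1 (p. 8)] [cite: BDKim2013, Cor. 3.15 (p. 199)]
[cite: Miller2011LMS, §1 and Def. 1.1] -/
theorem bsdp_of_residuals (hPub : PublishedInputsX6) (hAc : PublishedAcInputsX6Err) (hRest : EisensteinHalfFiveLeRest)
    (hT : EisensteinHalfAtThree) (hc : r.check = true) (h : r.Claim) : BSDp r.curve r.p := by
  rcases (r.reduction_of_check hc).1 with h3 | h5
  · exact r.bsdp_of_p_eq_three hPub hT hc h h3
  · by_cases hE : HasErratumPrime r.curve r.p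
    · exact Summit.BirchSwinnertonDyer.BirchSwinnertonDyer.Theorems.X6.bsdp_of_publishedInputsX6_of_publishedAcInputsX6Err_of_hasErratumPrime
        r.curve r.p hPub hAc h5 (r.classX6_of_check hc) h.1 hE
    · exact Summit.BirchSwinnertonDyer.BirchSwinnertonDyer.Theorems.X6.bsdp_of_publishedInputsX6_of_rest_of_not_hasErratumPrime
        r.curve r.p hPub hRest h5 (r.classX6_of_check hc) h.1 hE

end Record

/-! ### §2 List forms (instance binders discharged by the recheck) and the census corollaries -/

section Lists

variable {rs : List Record}

/-- **ERR road, list form, instance-free**: for every record of a `certified` list whose claims hold, at `p ≥ 5` with the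
Err certificate, `BSD(E,p)` over `PublishedInputsX6 ∧ PublishedAcInputsX6Err` — NO open crux of the route is used.
[cite: Kobayashi2003, Thm. 1.2 (p. 2) and Thm. 4.1 (p. 8)] [cite: BDKim2013, Cor. 3.15 (p. 199)]
[cite: Miller2011LMS, §1 and Def. 1.1] -/
theorem bsdp_of_certified_of_claims_of_errAt (hPub : PublishedInputsX6) (hAc : PublishedAcInputsX6Err)
    (hC : certified rs = true) (hcl : Claims rs) (r : Record) (hr : r ∈ rs) (h5 : 5 ≤ r.p) (he : r.errAt = true) :
    haveI := r.fact_prime_of_check (check_of_mem_of_certified hC hr)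
    haveI := (r.elliptic_and_minimal_of_check (check_of_mem_of_certified hC hr)).1
    haveI := (r.elliptic_and_minimal_of_check (check_of_mem_of_certified hC hr)).2
    BSDp r.curve r.p := by
  have hc := check_of_mem_of_certified hC hr
  haveI := r.fact_prime_of_check hc
  haveI := (r.elliptic_and_minimal_of_check hc).1
  haveI := (r.elliptic_and_minimal_of_check hc).2
  exact r.bsdp_of_errAt hPub hAc hc (hcl r hr) h5 he

/-- **All four items, list form, instance-free**: for every record of a `certified` list whose claims hold, `BSD(E,p)`
over `PublishedInputsX6`, `PublishedAcInputsX6Err`, `EisensteinHalfFiveLeRest`, `EisensteinHalfAtThree`.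
[cite: Kobayashi2003, Thm. 1.2 (p. 2) and Thm. 4.1 (p. 8)] [cite: BDKim2013, Cor. 3.15 (p. 199)]
[cite: Miller2011LMS, §1 and Def. 1.1] -/
theorem bsdp_of_certified_of_claims_of_residuals (hPub : PublishedInputsX6) (hAc : PublishedAcInputsX6Err)
    (hRest : EisensteinHalfFiveLeRest) (hT : EisensteinHalfAtThree) (hC : certified rs = true) (hcl : Claims rs)
    (r : Record) (hr : r ∈ rs) :
    haveI := r.fact_prime_of_check (check_of_mem_of_certified hC hr)
    haveI := (r.elliptic_and_minimal_of_check (check_of_mem_of_certified hC hr)).1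
    haveI := (r.elliptic_and_minimal_of_check (check_of_mem_of_certified hC hr)).2
    BSDp r.curve r.p := by
  have hc := check_of_mem_of_certified hC hr
  haveI := r.fact_prime_of_check hc
  haveI := (r.elliptic_and_minimal_of_check hc).1
  haveI := (r.elliptic_and_minimal_of_check hc).2
  exact r.bsdp_of_residuals hPub hAc hRest hT hc (hcl r hr)

end Lists

/-- **The 107 Err census cells at `p ≥ 5`: `BSD(E,p)` by name with NO open crux** — over `PublishedInputsX6 ∧
PublishedAcInputsX6Err` and the records' claims, for every record of `allRecords` with `5 ≤ p` and the Err certificate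
(`errRest_counts_allRecords`: 107 of the 113 records at `p ≥ 5`). Tier of the pack: HELD (the referee rules); cells are
booked by the director, not here. [cite: Kobayashi2003, Thm. 1.2 (p. 2) and Thm. 4.1 (p. 8)]
[cite: BDKim2013, Cor. 3.15 (p. 199)] [cite: Miller2011LMS, §1 and Def. 1.1] -/
theorem bsdp_of_mem_errAt (hPub : PublishedInputsX6) (hAc : PublishedAcInputsX6Err) (hcl : Claims allRecords)
    (r : Record) (hr : r ∈ allRecords) (h5 : 5 ≤ r.p) (he : r.errAt = true) :
    haveI := r.fact_prime_of_check (check_of_mem_of_certified certified_allRecords hr)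
    haveI := (r.elliptic_and_minimal_of_check (check_of_mem_of_certified certified_allRecords hr)).1
    haveI := (r.elliptic_and_minimal_of_check (check_of_mem_of_certified certified_allRecords hr)).2
    BSDp r.curve r.p :=
  bsdp_of_certified_of_claims_of_errAt hPub hAc certified_allRecords hcl r hr h5 he

/-- **All 734 census cells: `BSD(E,p)` over exactly the route's pack, anticyclotomic pack and two residual cruxes**
(and the records' claims). [cite: Kobayashi2003, Thm. 1.2 (p. 2) and Thm. 4.1 (p. 8)]
[cite: BDKim2013, Cor. 3.15 (p. 199)] [cite: Miller2011LMS, §1 and Def. 1.1] -/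
theorem bsdp_of_mem_of_residuals (hPub : PublishedInputsX6) (hAc : PublishedAcInputsX6Err)
    (hRest : EisensteinHalfFiveLeRest) (hT : EisensteinHalfAtThree) (hcl : Claims allRecords)
    (r : Record) (hr : r ∈ allRecords) :
    haveI := r.fact_prime_of_check (check_of_mem_of_certified certified_allRecords hr)
    haveI := (r.elliptic_and_minimal_of_check (check_of_mem_of_certified certified_allRecords hr)).1
    haveI := (r.elliptic_and_minimal_of_check (check_of_mem_of_certified certified_allRecords hr)).2
    BSDp r.curve r.p :=
  bsdp_of_certified_of_claims_of_residuals hPub hAc hRest hT certified_allRecords hcl r hr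

/-- **Which item each census record waits on** (kernel recount): a listed record is at `p = 3` (crux
`EisensteinHalfAtThree`), or at `p ≥ 5` with the Err certificate (no open crux), or at `p ≥ 5` with the Rest certificate
(crux `EisensteinHalfFiveLeRest`) — from the recheck (`p = 3 ∨ 5 ≤ p`) and `errAt_or_restAt_of_mem`. [folklore] -/
theorem item_trichotomy_of_mem (r : Record) (hr : r ∈ allRecords) :
    r.p = 3 ∨ (5 ≤ r.p ∧ r.errAt = true) ∨ (5 ≤ r.p ∧ r.restAt = true) := by
  rcases (r.reduction_of_check (check_of_mem_of_certified certified_allRecords hr)).1 with h3 | h5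
  · exact Or.inl h3
  · rcases errAt_or_restAt_of_mem r hr with ⟨he, -⟩ | ⟨-, hrest⟩
    · exact Or.inr (Or.inl ⟨h5, he⟩)
    · exact Or.inr (Or.inr ⟨h5, hrest⟩)

/-- **The open-crux count of the census**: exactly 627 of the 734 records (the 6 Rest records at `p ≥ 5` and all 621 at
`p = 3`) wait on an OPEN crux of the route; the other 107 (Err at `p ≥ 5`) wait on none (pack tier HELD). [folklore] -/
theorem openCrux_count_allRecords :
    (allRecords.filter fun r => r.p = 3 ∨ r.restAt = true).length = 627 ∧
    (allRecords.filter fun r => 5 ≤ r.p ∧ r.errAt = true).length = 107 ∧ allRecords.length = 734 := by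
  refine ⟨by decide +kernel, errRest_counts_allRecords.1, count_allRecords.1⟩

/-! ### §3 `hWeq` adapters for the cell files: from a certified list and a decided membership to `BSD(E,p)` at the cell -/

section Adapters

variable {rs : List Record} {W : WeierstrassCurve ℚ} [W.IsElliptic] [W.IsGloballyMinimal]
  {a1 a2 a3 a4 a6 : ℤ} {p : ℕ} [Fact p.Prime]

/-- **`BSD(E,p)` at an Err cell in the `hWeq` shape** (any of the 107; membership `by decide +kernel` in the part
`recordsNN` holding the label): over `PublishedInputsX6 ∧ PublishedAcInputsX6Err` and an explicit `r_an = 0` (the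
consumer's: an enclosure line, §4, or the claim) — `ClassX6` and `HasErratumPrime` are the record's kernel theorems.
NO open crux. [cite: Kobayashi2003, Thm. 1.2 (p. 2) and Thm. 4.1 (p. 8)] [cite: BDKim2013, Cor. 3.15 (p. 199)]
[cite: SilvermanAEC2009, VII.5 Prop. 5.1(b)] [cite: Miller2011LMS, §1 and Def. 1.1] -/
theorem bsdp_of_exists_errAt (hrs : certified rs = true)
    (h : ∃ r ∈ rs, r.ainvs = [a1, a2, a3, a4, a6] ∧ r.p = p ∧ r.errAt = true)
    (hWeq : W = ⟨a1, a2, a3, a4, a6⟩) (hPub : PublishedInputsX6) (hAc : PublishedAcInputsX6Err) (h5 : 5 ≤ p)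
    (h0 : W.analyticRank = 0) : BSDp W p := by
  obtain ⟨r, hr, hA, hp, he⟩ := h
  have hc := check_of_mem_of_certified hrs hr
  have hW : W = r.curve := by rw [hWeq]; exact r.curve_eq hA
  subst hW
  subst hp
  exact Summit.BirchSwinnertonDyer.BirchSwinnertonDyer.Theorems.X6.bsdp_of_publishedInputsX6_of_publishedAcInputsX6Err_of_hasErratumPrime
    r.curve r.p hPub hAc h5 (r.classX6_of_check hc) h0 (r.hasErratumPrime_of_check hc he)

/-- **`BSD(E,p)` at a Rest cell in the `hWeq` shape** (any of the 6 at `p ≥ 5`): over `PublishedInputsX6`, the OPEN crux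
`EisensteinHalfFiveLeRest` and an explicit `r_an = 0`. [cite: Kobayashi2003, Thm. 1.2 (p. 2) and Thm. 4.1 (p. 8)]
[cite: BDKim2013, Cor. 3.15 (p. 199)] [cite: SilvermanAEC2009, VII.5 Prop. 5.1(a) and (b)] [cite: Miller2011LMS, §1 and Def. 1.1] -/
theorem bsdp_of_exists_restAt (hrs : certified rs = true)
    (h : ∃ r ∈ rs, r.ainvs = [a1, a2, a3, a4, a6] ∧ r.p = p ∧ r.restAt = true)
    (hWeq : W = ⟨a1, a2, a3, a4, a6⟩) (hPub : PublishedInputsX6) (hRest : EisensteinHalfFiveLeRest) (h5 : 5 ≤ p)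
    (h0 : W.analyticRank = 0) : BSDp W p := by
  obtain ⟨r, hr, hA, hp, hrest⟩ := h
  have hc := check_of_mem_of_certified hrs hr
  have hW : W = r.curve := by rw [hWeq]; exact r.curve_eq hA
  subst hW
  subst hp
  exact Summit.BirchSwinnertonDyer.BirchSwinnertonDyer.Theorems.X6.bsdp_of_publishedInputsX6_of_rest_of_not_hasErratumPrime
    r.curve r.p hPub hRest h5 (r.classX6_of_check hc) h0 (r.not_hasErratumPrime_of_check hc hrest)

/-- **`BSD(E,3)` at a `p = 3` cell in the `hWeq` shape** (any of the 621): over `PublishedInputsX6`, the OPEN crux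
`EisensteinHalfAtThree` and an explicit `r_an = 0`. [cite: Kobayashi2003, Thm. 1.2 (p. 2) and Thm. 4.1 (p. 8)]
[cite: BDKim2013, Cor. 3.15 (p. 199)] [cite: SilvermanAEC2009, VII.5 Prop. 5.1(a)] [cite: Miller2011LMS, §1 and Def. 1.1] -/
theorem bsdp_of_exists_three (hrs : certified rs = true)
    (h : ∃ r ∈ rs, r.ainvs = [a1, a2, a3, a4, a6] ∧ r.p = p ∧ r.p = 3)
    (hWeq : W = ⟨a1, a2, a3, a4, a6⟩) (hPub : PublishedInputsX6) (hT : EisensteinHalfAtThree)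
    (h0 : W.analyticRank = 0) : BSDp W p := by
  obtain ⟨r, hr, hA, hp, h3⟩ := h
  have hc := check_of_mem_of_certified hrs hr
  have hW : W = r.curve := by rw [hWeq]; exact r.curve_eq hA
  subst hW
  subst hp
  exact Summit.BirchSwinnertonDyer.BirchSwinnertonDyer.Theorems.X6.bsdp_of_publishedInputsX6_of_atThree
    r.curve r.p hPub hT h3 (r.classX6_of_check hc) h0

end Adapters

/-! ### §4 The claim's first conjunct from an enclosure line, and the T3 witness cell -/

/-- **`r_an = 0` from an enclosure line, period-agnostic form** (any real `Ω` — e.g. the engine's own `ω₁` — in place of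
the newform period `Ω⁺_f` of the tree's `Supersingular.analyticRank_eq_zero_of_LOneBall`, whose verbatim cell-file shape is
served by `bsdp_of_exists_errAt_of_LOneBall` below). If `L(E,s)` has an entire continuation for every `E/ℚ` (modularity,
`hasEntireLFunction_rat` — conjunct 8 of `PublishedInputsX6`) and some real multiple `c·(c'·(Re L(E,1)/Ω))` of the
`L`-value is enclosed in a ball `|· − mid| ≤ rad ≤ ε` whose centre is within `ε` of a NONZERO integer `v`, with `2ε < 1`,
then `L(E,1) ≠ 0`, i.e. the analytic rank is `0` (`analyticRank_eq_zero_iff_holds`: order of vanishing of an entire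
function not identically zero near `1`). With `Ω = plusPeriod f`, `c = c' = 1`, `v = 98`, `ε = 10⁻²⁰` the enclosure is
the `hball0` binder of `Theorems/PrintX6Cell12927e1FromInputs.lean`; the kit job that produces `mid, rad` is the consumer's
evidence, not the kernel's. [cite: BirchSwinnertonDyer1965]
[cite: BCDTJAMS2001, Theorem A] -/
theorem analyticRank_eq_zero_of_enclosure {W : WeierstrassCurve ℚ} [W.IsElliptic]
    (hmod' : WeierstrassCurve.hasEntireLFunction_rat) {c c' : ℕ} {Ω ε : ℝ} {v : ℤ} (hv : v ≠ 0) (hε : 2 * ε < 1)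
    (hball0 : ∃ mid rad : ℝ, rad ≤ ε ∧ |mid - (v : ℝ)| ≤ ε ∧
      |(c : ℝ) * ((c' : ℝ) * ((W.entireLFunction 1).re / Ω)) - mid| ≤ rad) :
    W.analyticRank = 0 := by
  obtain ⟨mid, rad, hrad, hmid, hball⟩ := hball0
  refine (W.analyticRank_eq_zero_iff_holds (hmod' W)).2 fun hL0 => ?_
  rw [hL0] at hball
  simp only [Complex.zero_re, zero_div, mul_zero, zero_sub, abs_neg] at hball
  have h1 : (1 : ℝ) ≤ |(v : ℝ)| := by
    rw [← Int.cast_abs]; exact_mod_cast Int.one_le_abs hv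
  have h2 : |(v : ℝ)| - |mid| ≤ |(v : ℝ) - mid| := abs_sub_abs_le_abs_sub _ _
  rw [abs_sub_comm] at hmid
  linarith

/-- **`BSD(E,p)` at an Err cell from the inputs and an ENCLOSURE LINE** (the cell files' binder list exactly: `hPub`,
`hAc`, `hWeq`, the enclosure; membership `by decide +kernel`): `r_an = 0` by `analyticRank_eq_zero_of_enclosure` with
modularity = conjunct 8 of `PublishedInputsX6`, then `bsdp_of_exists_errAt`. NO open crux; no Cassels–Tate; no Selmer
certificate. [cite: Kobayashi2003, Thm. 1.2 (p. 2) and Thm. 4.1 (p. 8)] [cite: BDKim2013, Cor. 3.15 (p. 199)]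
[cite: BirchSwinnertonDyer1965] [cite: Miller2011LMS, §1 and Def. 1.1] -/
theorem bsdp_of_exists_errAt_of_enclosure {rs : List Record} {W : WeierstrassCurve ℚ} [W.IsElliptic]
    [W.IsGloballyMinimal] {a1 a2 a3 a4 a6 : ℤ} {p : ℕ} [Fact p.Prime] (hrs : certified rs = true)
    (h : ∃ r ∈ rs, r.ainvs = [a1, a2, a3, a4, a6] ∧ r.p = p ∧ r.errAt = true)
    (hWeq : W = ⟨a1, a2, a3, a4, a6⟩) (hPub : PublishedInputsX6) (hAc : PublishedAcInputsX6Err) (h5 : 5 ≤ p)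
    {c c' : ℕ} {Ω ε : ℝ} {v : ℤ} (hv : v ≠ 0) (hε : 2 * ε < 1)
    (hball0 : ∃ mid rad : ℝ, rad ≤ ε ∧ |mid - (v : ℝ)| ≤ ε ∧
      |(c : ℝ) * ((c' : ℝ) * ((W.entireLFunction 1).re / Ω)) - mid| ≤ rad) :
    BSDp W p :=
  bsdp_of_exists_errAt hrs h hWeq hPub hAc h5 (analyticRank_eq_zero_of_enclosure hPub.2.2.2.2.2.2.2.1 hv hε hball0)

/-- **`BSD(E,p)` at an Err cell from the inputs and the cell files' LEVEL-ONE ENCLOSURE LINE, verbatim** — binders exactly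
`hPub`, `hAc`, `hWeq`, the newform-level `f` of the period `Ω⁺_f`, and the engine's
`hball0 : ∃ mid rad, rad ≤ R ∧ |mid − I| ≤ Mr ∧ |den·(c·(Re L(E,1)/Ω⁺_f)) − mid| ≤ rad` of `den·T₀ = den·L(E,1)/ω₁ = I`
(`c = c_∞`; `I ≠ 0` by `decide`, `R + Mr < 1` by `norm_num`; membership `by decide +kernel`): `r_an = 0` by the tree's
UNCONDITIONAL `Supersingular.analyticRank_eq_zero_of_LOneBall` (an enclosure away from `0` gives `L(E,1) ≠ 0`, then
`analyticRank_eq_zero_of_entireLFunction_one_ne_zero`), then `bsdp_of_exists_errAt`. The ball (two implementations) and the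
period transfer `Ω⁺_f = c_∞·ω₁` (optimal curve, Manin constant `1`) are the consumer's job evidence, outside the kernel, as
in every `hball0` consumer. NO open crux; no Cassels–Tate; no Selmer certificate.
[cite: Kobayashi2003, Thm. 1.2 (p. 2) and Thm. 4.1 (p. 8)] [cite: BDKim2013, Cor. 3.15 (p. 199)] [cite: BirchSwinnertonDyer1965]
[cite: MazurTateTeitelbaum1986Invent, §I.8] [cite: Miller2011LMS, §1 and Def. 1.1] -/
theorem bsdp_of_exists_errAt_of_LOneBall {rs : List Record} {W : WeierstrassCurve ℚ} [W.IsElliptic]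
    [W.IsGloballyMinimal] {a1 a2 a3 a4 a6 : ℤ} {p : ℕ} [Fact p.Prime] (hrs : certified rs = true)
    (h : ∃ r ∈ rs, r.ainvs = [a1, a2, a3, a4, a6] ∧ r.p = p ∧ r.errAt = true)
    (hWeq : W = ⟨a1, a2, a3, a4, a6⟩) (hPub : PublishedInputsX6) (hAc : PublishedAcInputsX6Err) (h5 : 5 ≤ p)
    {N : ℕ} [NeZero N] (f : CuspForm (Gamma0 N) 2) (R Mr den c : ℝ) (I : ℤ) (hI : I ≠ 0) (hsmall : R + Mr < 1)
    (hball0 : ∃ mid rad : ℝ, rad ≤ R ∧ |mid - ((I : ℤ) : ℝ)| ≤ Mr ∧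
      |den * (c * ((W.entireLFunction 1).re / plusPeriod f)) - mid| ≤ rad) :
    BSDp W p :=
  bsdp_of_exists_errAt hrs h hWeq hPub hAc h5 (analyticRank_eq_zero_of_LOneBall f R Mr den c I hI hsmall hball0)

/-- **The route's T3 witness cell `(22678e1, 5)` is an Err cell: `BSD(E,5)` there over the two input conjunctions and
`r_an = 0`** (Cremona's minimal model `[1,0,0,3140254662,−139987982322460]`, `N = 2·17·23·29`, non-split at `17, 23, 29`;
record in `records14`, `hasErratumPrime_cell_22678e1_at5`). A second road at this cell next to p4's descent closure
`PrintX6Cell22678e1FromInputs` (p546341): same `PublishedInputsX6`, plus `PublishedAcInputsX6Err` (HELD), minus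
Cassels–Tate and the Selmer certificate. Per pair; not a class theorem.
[cite: Cremona2006, Table 1 (Cremona label 22678e1)] [cite: Kobayashi2003, Thm. 1.2 (p. 2) and Thm. 4.1 (p. 8)]
[cite: BDKim2013, Cor. 3.15 (p. 199)] [cite: Miller2011LMS, §1 and Def. 1.1] -/
theorem bsdp_cell_22678e1_at5_of_publishedInputsX6_of_publishedAcInputsX6Err [Fact (Nat.Prime 5)]
    {W : WeierstrassCurve ℚ} [W.IsElliptic] [W.IsGloballyMinimal]
    (hWeq : W = ⟨1, 0, 0, 3140254662, -139987982322460⟩) (hPub : PublishedInputsX6) (hAc : PublishedAcInputsX6Err)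
    (h0 : W.analyticRank = 0) : BSDp W 5 :=
  bsdp_of_exists_errAt certified_records14 (by decide +kernel) hWeq hPub hAc (by norm_num) h0

end Summit.BirchSwinnertonDyer.Rank1Residual.X6.PrintCert
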